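import Summits.BirchSwinnertonDyer.BirchSwinnertonDyer.Theorems.ByReductionTypeAtTwoOrdKatoHalfAtTwoIsoSteinbergDefs
import Summits.BirchSwinnertonDyer.BirchSwinnertonDyer.Theorems.SmallImageMuTransferMuTransferX9CoreAssemblyOdd
import Literature.NumberTheory.EllipticCurves.Kato2004.UniversalNormsIntegralProofs
import Literature.NumberTheory.GaloisCohomology.PoitouTateNumberField
import HarnessLib

/-!
# Route ByReductionTypeAtTwo, crux `OrdKatoHalfAtTwoIso` (stmt-BirchSwinnertonDyer-19573), line `steinberg-fibre-at-two`:
# the Ω-ROAD RE-CUT of `stub_port` (STUB-PLAN TOP road) — three DISPLAYED statements and the KERNEL composition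
# `stub_port_of_rankOne : SelmerSideTwo → ChebotarevTranspositionTwo → KolyvaginRankOneTwo → CoreTheoremATwoResidue`

Seat `cruxlead-stmt-BirchSwinnertonDyer-19573-g0` (LEAD PROVER, MODE LINE; HOME `run/shared/lean/pub/bsd-2adic/`). CREDIT: the three
definitions and both composition proofs are VERBATIM the companion file of card #9's stub-ideation, `sidea-stub_port-2`
(`Cruxes/OrdKatoHalfAtTwoIso/STUB_IDEAS_stub_port_2_Helpers.lean` @6fa44ee3f35619ac, commit a43a5a6b4ded), moved into the Theorems tree so
that the registered skeleton (v5) and the stub-workers' helper files can import them; road choice = the stub-critic's STUB-PLAN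
(`Cruxes/OrdKatoHalfAtTwoIso/STUB-PLAN-stub_port.md`, `scrit-stub_port` g0: Ω road TOP, S₃-port co-equal insurance, ≈ 70 % shared trunk).
HONEST FRAMING (cell bsd-2adic): BSD is not proved by any of this; the crux is not proved; `SelmerSideTwo` (M, shared TRUNK T1),
`ChebotarevTranspositionTwo` (M after the critic's F3/F5) and `KolyvaginRankOneTwo` (XL, the research body) are OPEN statements DISPLAYED
BY NAME — nothing is asserted about them; the two theorems are conditional on them (plus the two tree facts
`Kato2004.mem_pSmul_of_red_eq_zero_holds`, `poitouTate_sum_localTatePairing_eq_zero_holds ℚ`, both proved for `p = 2`).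

* `SelmerSideTwo` — the Selmer-side statement hG1 of the odd core (`…X9CoreAssemblyOdd.lean:72–95`) at `p = 2`: binders `Surj(2)`,
  `κ` cyclotomic, top generator; no `p ≠ 2`, no `¬Surj`, no `hEP/hPT` (unused by the odd proof except through little Fermat, true at 2).
* `ChebotarevTranspositionTwo` — STEPS 1+2 in rank one: a Chebotarev prime `q ∉ S` with transposition Frobenius of depth `≥ n` and
  non-degenerate bottom pairing (replaces the odd core's joint-value / exact-depth steps; plain Chebotarev F3 + the critic's F5).
* `KolyvaginRankOneTwo` — STEPS 3–4 in rank one at 2: the Kolyvagin class of ONE transposition prime from a genuine `2`-adic class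
  (`IsEulerSystemClassTwo`) and the reciprocity law (interior K1–K4 of the STUB-PLAN; B2-exact per the critic's F4).
* `modPTwist_apply_zero` — (H-0) the bottom coefficient of the twisted action.
* `coreTwoResidue_of_rankOne`, `stub_port_of_rankOne` — the 40-line mirror of `CoreAssembly.coreOdd_of_selmerDual_of_stepsTwoFour` with
  level `J = a+ε+2`, depth `n = J`, count `convCoeff_zero_one_eq_zero_of_reciprocity … Nat.prime_two` (kernel-checked by the ideator and the critic).

References: sidea-stub_port-2 `STUB-IDEAS-stub_port-2.md` @ab952f9722e3fc7a; scrit `STUB-PLAN-stub_port.md`; B. Mazur, K. Rubin, Mem. AMS 799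
(2004) §§1–5 [MazurRubin2004]; K. Kato, Kodai Math. J. 22 (1999) [Kato1999KMJ], Astérisque 295 (2004) §13 [Kato2004Asterisque].
-/

set_option autoImplicit false
set_option linter.dupNamespace false

noncomputable section

open scoped Classical NumberField
open WeierstrassCurve Field IsDedekindDomain NumberField
open Literature.NumberTheory.GaloisRepresentations
open Literature.NumberTheory.GaloisCohomology
open Literature.NumberTheory.EllipticCurves
open Literature.NumberTheory.EllipticCurves.Kato2004
open Literature.NumberTheory.EllipticCurves.Kato2004.EulerSystemValues
open Summit.BirchSwinnertonDyer.BirchSwinnertonDyer.Rank1Residual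
open Summit.BirchSwinnertonDyer.BirchSwinnertonDyer.Rank1Residual.CoreAssembly

universe u

namespace Summit.BirchSwinnertonDyer.BirchSwinnertonDyer.Theorems.SteinbergFibreAtTwo

/-! ## §1 The Selmer side at 2 (shared TRUNK T1) -/

/-- [OPEN, shared trunk T1 of both roads; M] **The Selmer-side statement of the core AT `p = 2`**: VERBATIM
`SelmerDual.stub_selmerDualOdd_holds` (hG1 of `…X9CoreAssemblyOdd.lean:72–95`) with `p ≠ 2, Irr, ¬Surj ↦ p = 2, Surj(2)` and the unused
`hEP`/`hPT` binders dropped. From a `Sel₀(ℚ_∞)[2]`-class `y` with `T^J y ≠ 0`: a global class `Ψ` of `𝒯_{J+1}(χ⁻¹)` with `T^J Ψ ≠ 0`,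
unramified off `S`, `T^ε Ψ` locally trivial on `S`. The single odd-prime ingredient of the kernel proof is little Fermat
(`SelmerDual.iterate_conj_sub_id_eq_zero_of_pow`), true at 2 by Frobenius. Nothing asserted. [cite: GreenbergLNM1716, §3] [cite: MazurRubin2004, §5.3] -/
@[conjecture] def SelmerSideTwo : Prop :=
  ∀ (W : WeierstrassCurve ℚ) [W.IsElliptic] [W.IsGloballyMinimal]
    (κ : ZpExtension ℚ 2) (γ : absoluteGaloisGroup ℚ),
    W.HasSurjectiveModNGaloisRep 2 → κ.IsCyclotomic → κ.IsTopGenerator γ →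
    ∀ (S₀ : Set (HeightOneSpectrum (𝓞 ℚ))), S₀.Finite →
    ∃ (ε : ℕ) (S : Set (HeightOneSpectrum (𝓞 ℚ))), S.Finite ∧ S₀ ⊆ S ∧
      ∀ (J : ℕ) (y : Literature.NumberTheory.EllipticCurves.subgroupH1 κ.kerSubgroup
          (WeierstrassCurve.geomTorsion W (2 : ℤ))),
        W.torsionToPrimaryH1Sub 2 κ.kerSubgroup y ∈ W.fineSelmerInfty κ →
        (⇑(Literature.NumberTheory.EllipticCurves.conjH1 κ.kerSubgroup
            (WeierstrassCurve.geomTorsion W (2 : ℤ)) γ -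
          AddMonoidHom.id (Literature.NumberTheory.EllipticCurves.subgroupH1 κ.kerSubgroup
            (WeierstrassCurve.geomTorsion W (2 : ℤ)))))^[J] y ≠ 0 →
        ∃ Ψ : galoisCohomology (W.modPTwist 2 κ.invTwist (J + 1)) 1,
          (κ.invTwist.shiftH1 (W.torsionGaloisModule (2 : ℤ))
              (fun P : WeierstrassCurve.geomTorsion W (2 : ℤ) => AddSubgroup.torsionBy.nsmul P)
              (J + 1))^[J] Ψ ≠ 0 ∧
          (∀ v : HeightOneSpectrum (𝓞 ℚ), v ∉ S →
            galoisCohomology.localization (W.modPTwist 2 κ.invTwist (J + 1)) (Sum.inr v) 1 Ψ ∈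
              DiscreteGaloisModule.unramifiedSubgroup
                (GaloisRep.toLocal v (W.modPTwist 2 κ.invTwist (J + 1))) 1) ∧
          (∀ v : HeightOneSpectrum (𝓞 ℚ), v ∈ S →
            galoisCohomology.localization (W.modPTwist 2 κ.invTwist (J + 1)) (Sum.inr v) 1
              ((κ.invTwist.shiftH1 (W.torsionGaloisModule (2 : ℤ))
                (fun P : WeierstrassCurve.geomTorsion W (2 : ℤ) => AddSubgroup.torsionBy.nsmul P)
                (J + 1))^[ε] Ψ) = 0)


/-! ## §2 STEPS 1+2 in rank one: the transposition prime -/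

/-- [OPEN; M] **(H-C) a Chebotarev prime `q ∉ S` whose Frobenius is a TRANSPOSITION on `E[2]`, of depth `≥ n`, with
NON-DEGENERATE bottom pairing `e₂((ρ̄(Fr) − 1)·κ̄′(Fr), ψ̄(Fr)) ≠ 0`** (replaces the odd core's `exists_jointValue_weil_ne_zero_of_ne_two` +
`exists_isArithFrobAt_mem_inf_ker_apply_eq_and_depth_of_ne_two`; no exact depth, no E-split prime, no Goursat). Critic's route: both bottom
classes non-zero on `G_{Fℚ_n}` (Steinberg–Sah p657595/p658151), `S₃`-stable subgroups of `E[2]²` with both projections onto are `E[2]²` or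
the graph of `id`, `ker(1+c) = im(c−1) = ℓ_c` and `e((c−1)x, y) = 1` off `ℓ_c` (F5), plain Chebotarev for open normal subgroups
(`ChebotarevOpenSubgroup.exists_isArithFrobAt_mul_inv_mem_not_mem`, F3), `c ∈ G_{ℚ_n}` (`ℚ_n` real). Nothing asserted.
[cite: MazurRubin2004, §3.6 and Prop. 1.3.2] [cite: Serre1972, §5.3] -/
@[conjecture] def ChebotarevTranspositionTwo : Prop :=
  ∀ (W : WeierstrassCurve ℚ) [W.IsElliptic] [W.IsGloballyMinimal] (κ : ZpExtension ℚ 2)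
    (γ : absoluteGaloisGroup ℚ),
    W.HasSurjectiveModNGaloisRep 2 → W.Δ < 0 → κ.IsCyclotomic → κ.IsTopGenerator γ →
    ∀ (κ' : κ.twistTower (W.torsionGaloisModule (2 : ℤ))
        (fun P : WeierstrassCurve.geomTorsion W (2 : ℤ) => AddSubgroup.torsionBy.nsmul P)),
      κ.towerConst (W.torsionGaloisModule (2 : ℤ)) (fun P => AddSubgroup.torsionBy.nsmul P) κ' ≠ 0 →
    ∀ (J : ℕ) (φ : contOneCocycles (W.modPTwist 2 κ (J + 1)).toTopRep),
      oneCocycleClass (W.modPTwist 2 κ (J + 1)).toTopRep φ = κ'.1 (J + 1) →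
    ∀ (ψ : contOneCocycles (W.modPTwist 2 κ.invTwist (J + 1)).toTopRep),
      (κ.invTwist.shiftH1 (W.torsionGaloisModule (2 : ℤ))
          (fun P : WeierstrassCurve.geomTorsion W (2 : ℤ) => AddSubgroup.torsionBy.nsmul P) (J + 1))^[J]
        (oneCocycleClass (W.modPTwist 2 κ.invTwist (J + 1)).toTopRep ψ) ≠ 0 →
    ∀ (eW : WeierstrassCurve.geomTorsion W (2 : ℤ) → WeierstrassCurve.geomTorsion W (2 : ℤ) →
        AlgebraicClosure ℚ)
      (hμ : ∀ S T, eW S T ^ 2 = 1)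
      (hadd₁ : ∀ S₁' S₂' T, eW (S₁' + S₂') T = eW S₁' T * eW S₂' T)
      (hadd₂ : ∀ S T₁ T₂, eW S (T₁ + T₂) = eW S T₁ * eW S T₂),
      (∀ T, eW T T = 1) → (∀ T, (∀ S, eW S T = 1) → T = 0) →
      (∀ (σ : absoluteGaloisGroup ℚ) (S T : WeierstrassCurve.geomTorsion W (2 : ℤ)),
        σ • eW S T = eW (σ • S) (σ • T)) →
    ∀ (S : Set (HeightOneSpectrum (𝓞 ℚ))), S.Finite → ∀ (n : ℕ),
    ∃ q : HeightOneSpectrum (𝓞 ℚ), q ∉ S ∧ ∃ 𝔓 ∈ q.primesAbove, ∃ Fr : absoluteGaloisGroup ℚ,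
      IsArithFrobAt (𝓞 ℚ) Fr 𝔓 ∧
      WeierstrassCurve.galoisRepTorsion W 2 Fr ≠ 1 ∧ WeierstrassCurve.galoisRepTorsion W 2 (Fr * Fr) = 1 ∧
      Fr ∈ κ.layerSubgroup n ∧
      weilPairingHom W 2 eW hμ hadd₁ hadd₂ (Fr • φ.1 Fr ⟨0, Nat.succ_pos J⟩ - φ.1 Fr ⟨0, Nat.succ_pos J⟩)
        (ψ.1 Fr ⟨0, Nat.succ_pos J⟩) ≠ 0



/-! ## §3 STEPS 3–4 in rank one at 2: the Kolyvagin class of ONE transposition prime -/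

/-- [OPEN, the research body; XL — the stub to register after H-C lands] **(H-K) Kolyvagin's class of one transposition prime
and the reciprocity law at `p = 2`**: from a GENUINE `2`-adic class (`IsEulerSystemClassTwo`), for a transposition Frobenius
`Fr ∈ Γ^{2^n}` and `J ≤ 2^n` (so `γ_q` acts trivially on `Ω_J(χ)`, `Fr − 1 = (τ − 1) ⊗ 1 =: N`, `N² = 0`, `ker N = im N ≅ Ω_J`,
`P_q(x) ≡ (1 + x)²`), the Poitou–Tate sum for `(κ_q, Ψ)` gives: all convolution coefficients `< J − ε` of
`e(U·T^a·N(Φ(Fr)), Ψc(Fr))` vanish. Interior plan (STUB-PLAN §3Ω): K1 corestriction to `K = ℚ(√q*)` of the tame class (trunk T3/H16),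
K2 derivative over the order-2 group, K3 the value line `t̄_N = γ_q^{−2}·N·t̄₁` (critic's CC.`N_sq`/`ker_N_le`, B2-exact: F4), K4 the q-term
via the ur/tr split and prime-power tr×ur perfectness H-P. NOT in print at 2; nothing asserted.
[cite: MazurRubin2004, §§2–3 and Prop. 1.3.2] [cite: Kato2004Asterisque, §13 (shape only; nothing asserted)] -/
@[conjecture] def KolyvaginRankOneTwo : Prop :=
  ∀ (W : WeierstrassCurve ℚ) [W.IsElliptic] [W.IsGloballyMinimal]
    [ContinuousSMul ℤ_[2] (W.tateModule 2)] [Module.Free ℤ_[2] (W.tateModule 2)]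
    [Module.Finite ℤ_[2] (W.tateModule 2)]
    (κ : ZpExtension ℚ 2) (γ : absoluteGaloisGroup ℚ) (I : IwasawaH1Data W 2 κ γ) (hκ : κ.IsCyclotomic),
    W.HasSurjectiveModNGaloisRep 2 → W.Δ < 0 → κ.IsTopGenerator γ →
    poitouTate_sum_localTatePairing_eq_zero ℚ →
    ∀ (s : I.H), IsEulerSystemClassTwo W hκ I s →
    ∃ (S₀ : Set (HeightOneSpectrum (𝓞 ℚ))), S₀.Finite ∧
      ∀ (a : ℕ) (κ' : κ.twistTower (W.torsionGaloisModule (2 : ℤ))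
          (fun P : WeierstrassCurve.geomTorsion W (2 : ℤ) => AddSubgroup.torsionBy.nsmul P)),
        (κ.towerShift (W.torsionGaloisModule (2 : ℤ))
            (fun P : WeierstrassCurve.geomTorsion W (2 : ℤ) => AddSubgroup.torsionBy.nsmul P))^[a]
          κ' = I.redTower s →
        ∀ (J n : ℕ), J ≤ 2 ^ n →
        ∀ (Φ : contOneCocycles (W.modPTwist 2 κ J).toTopRep),
          oneCocycleClass (W.modPTwist 2 κ J).toTopRep Φ = κ'.1 J →
        ∀ (ε : ℕ) (S₁ : Set (HeightOneSpectrum (𝓞 ℚ)))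
          (Ψ : galoisCohomology (W.modPTwist 2 κ.invTwist J) 1)
          (Ψc : contOneCocycles (W.modPTwist 2 κ.invTwist J).toTopRep),
          S₀ ⊆ S₁ →
          oneCocycleClass (W.modPTwist 2 κ.invTwist J).toTopRep Ψc = Ψ →
          (∀ v : HeightOneSpectrum (𝓞 ℚ), v ∉ S₁ →
            galoisCohomology.localization (W.modPTwist 2 κ.invTwist J) (Sum.inr v) 1 Ψ ∈
              DiscreteGaloisModule.unramifiedSubgroup
                (GaloisRep.toLocal v (W.modPTwist 2 κ.invTwist J)) 1) →
          (∀ v : HeightOneSpectrum (𝓞 ℚ), v ∈ S₁ →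
            galoisCohomology.localization (W.modPTwist 2 κ.invTwist J) (Sum.inr v) 1
              ((κ.invTwist.shiftH1 (W.torsionGaloisModule (2 : ℤ))
                (fun P : WeierstrassCurve.geomTorsion W (2 : ℤ) => AddSubgroup.torsionBy.nsmul P)
                J)^[ε] Ψ) = 0) →
        ∀ (eW : WeierstrassCurve.geomTorsion W (2 : ℤ) → WeierstrassCurve.geomTorsion W (2 : ℤ) →
            AlgebraicClosure ℚ)
          (hμ : ∀ S T, eW S T ^ 2 = 1)
          (hadd₁ : ∀ S₁' S₂' T, eW (S₁' + S₂') T = eW S₁' T * eW S₂' T)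
          (hadd₂ : ∀ S T₁ T₂, eW S (T₁ + T₂) = eW S T₁ * eW S T₂),
          (∀ T, eW T T = 1) → (∀ T, (∀ S, eW S T = 1) → T = 0) →
          (∀ (σ : absoluteGaloisGroup ℚ) (S T : WeierstrassCurve.geomTorsion W (2 : ℤ)),
            σ • eW S T = eW (σ • S) (σ • T)) →
        ∀ (q : HeightOneSpectrum (𝓞 ℚ)), q ∉ S₁ →
        ∀ 𝔓 ∈ q.primesAbove, ∀ (Fr : absoluteGaloisGroup ℚ), IsArithFrobAt (𝓞 ℚ) Fr 𝔓 →
          WeierstrassCurve.galoisRepTorsion W 2 Fr ≠ 1 → WeierstrassCurve.galoisRepTorsion W 2 (Fr * Fr) = 1 →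
          Fr ∈ κ.layerSubgroup n →
        ∃ U : Polynomial ℤ, ¬ (((2 : ℕ) : ℤ) ∣ U.coeff 0) ∧
          ∀ i : ℕ, i + ε < J →
            convCoeff (weilPairingHom W 2 eW hμ hadd₁ hadd₂) J i
              (Polynomial.aeval (shiftEnd (WeierstrassCurve.geomTorsion W (2 : ℤ)) J) U
                ((shiftEnd (WeierstrassCurve.geomTorsion W (2 : ℤ)) J ^ a)
                  (W.modPTwist 2 κ J Fr (Φ.1 Fr) - Φ.1 Fr)))
              (Ψc.1 Fr) = 0

/-! ## §4 (H-0) the bottom coefficient of the twisted action -/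

/-- (H-0) `(σ ·_{𝒯_J} x)₀ = σ • x₀`: the twist is `≡ 1 mod T` (`modPTwist_apply` + `unipotentPow_apply_zero`).
[cite: Washington1997, §13.1–§13.2] -/
theorem modPTwist_apply_zero (W : WeierstrassCurve ℚ) [W.IsElliptic] (κ : ZpExtension ℚ 2) {J : ℕ}
    (hJ : 0 < J) (σ : absoluteGaloisGroup ℚ) (x : Fin J → geomTorsion W (2 : ℤ)) :
    W.modPTwist 2 κ J σ x ⟨0, hJ⟩ = σ • x ⟨0, hJ⟩ := by
  rw [WeierstrassCurve.modPTwist_apply, ZpExtension.unipotentPow_apply_zero]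

/-! ## §5 The composition (mirror of `CoreAssembly.coreOdd_of_selmerDual_of_stepsTwoFour`, ll. 171–262): Step 0 (tree, any `p`) →
`J := a + ε + 2`, `n` with `2^n ≥ J` → bad class `y` (by contradiction) → `Ψ` (H-S) → `Φ` of `κ'_J` → (H-C) a transposition
prime with `e₂((ρ̄(Fr)−1)Φ(Fr)₀, Ψc(Fr)₀) ≠ 0` → (H-K) vanishing of the convolution coefficients → the count
`convCoeff_zero_one_eq_zero_of_reciprocity` (tree, `m := a`, needs `a + 1 + ε < J`) + `convCoeff_zero_eq` + (H-0) → ⊥. -/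

/-- **`CoreTheoremATwoResidue` from the Ω-road re-cut**: Step 0 (tree) + (H-S) + (H-C) + (H-K) + the count, given Kato §13.8 on the pin
(`hred`) and Poitou–Tate over ℚ (`hPT`) — verbatim the ideator's kernel-checked composition.
[cite: MazurRubin2004, Prop. 1.3.2 and §5.3] [cite: Kato2004Asterisque, §13.8 (pp. 228–229)] -/
theorem coreTwoResidue_of_rankOne (hred : mem_pSmul_of_red_eq_zero)
    (hPT : poitouTate_sum_localTatePairing_eq_zero ℚ)
    (hG1 : SelmerSideTwo) (hC : ChebotarevTranspositionTwo) (hK : KolyvaginRankOneTwo) :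
    CoreTheoremATwoResidue := by
  intro W _ _ _ _ _ κ γ I hκ _ _ h2 hΔ hγ hs
  obtain ⟨s, hES, hsp⟩ := hs
  have hirr : W.HasIrreducibleModPGaloisRep 2 := hasIrreducibleModPGaloisRep_of_hasSurjectiveModNGaloisRep W 2 h2
  -- STEP 0 (tree, any prime): `red_Ω s = T^a κ'`, `κ̄' ≠ 0`
  have ht : I.redTower s ≠ 0 := I.redTower_ne_zero_of_not_mem hred hκ hγ hsp
  obtain ⟨a, κ', hκ'a, -, hκ'c⟩ :=
    LevelE.exists_towerShift_iterate_eq_and_towerConst_ne_zero W 2 κ hirr ht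
  -- Steps 3–4 (H-K): the bad set `S₀`; the Selmer side (H-S): `ε`, `S₁ ⊇ S₀`
  obtain ⟨S₀, hS₀, hK'⟩ := hK W κ γ I hκ h2 hΔ hγ hPT s hES
  obtain ⟨ε, S₁, hS₁, hS₀₁, hG1'⟩ := hG1 W κ γ h2 hκ hγ S₀ hS₀
  -- a Weil pairing on `E[2]`
  obtain ⟨eW, hμ, hadd₁, hadd₂, halt, hnondeg, hgal⟩ := W.exists_weilPairing_holds 2 le_rfl (by norm_num)
  -- suppose the conclusion fails; level `J = e + 1 = a + ε + 2`, depth `n := e + 1` (`J ≤ 2^n`)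
  by_contra hcon
  push Not at hcon
  set e : ℕ := a + ε + 1 with he
  have hJn : e + 1 ≤ 2 ^ (e + 1) := (Nat.lt_pow_self (by norm_num)).le
  obtain ⟨y, hy, hyT⟩ := hcon e
  obtain ⟨Ψ, hΨT, hΨur, hΨε⟩ := hG1' e y hy hyT
  obtain ⟨Ψc, hΨc⟩ := oneCocycleClass_surjective _ Ψ
  subst hΨc
  obtain ⟨Φ, hΦ⟩ := oneCocycleClass_surjective _ (κ'.1 (e + 1))
  -- STEPS 1+2 in rank one (H-C): a transposition prime `q ∉ S₁` of depth `≥ e + 1`, non-degenerate bottom pairing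
  obtain ⟨q, hq, 𝔓, h𝔓, Fr, hFr, hFr1, hFr2, hFrn, hne⟩ :=
    hC W κ γ h2 hΔ hκ hγ κ' hκ'c e Φ hΦ Ψc hΨT eW hμ hadd₁ hadd₂ halt hnondeg hgal S₁ hS₁ (e + 1)
  -- STEPS 3–4 in rank one (H-K): the Kolyvagin class of `q` and reciprocity
  obtain ⟨U, hU0, hrec⟩ := hK' a κ' hκ'a (e + 1) (e + 1) hJn Φ hΦ ε S₁ _ Ψc hS₀₁ rfl hΨur hΨε eW hμ hadd₁
    hadd₂ halt hnondeg hgal q hq 𝔓 h𝔓 Fr hFr hFr1 hFr2 hFrn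
  -- the count (tree): `C_0 = 0` for the pair `(N Φ(Fr), Ψc(Fr))`
  have hpC : ∀ c : DiscreteGaloisModule.MuCarrier ℚ 2, ((2 : ℕ) : ℤ) • c = 0 :=
    natCast_zsmul_muCarrier_eq_zero ℚ 2
  obtain ⟨hC0, -⟩ := convCoeff_zero_one_eq_zero_of_reciprocity (weilPairingHom W 2 eW hμ hadd₁ hadd₂)
    Nat.prime_two hpC (m := a) (ε := ε) (by omega) U hU0 _ (Ψc.1 Fr) hrec
  rw [convCoeff_zero_eq _ (by omega), Pi.sub_apply, modPTwist_apply_zero] at hC0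
  exact hne hC0

/-- **`stub_port` from the three Ω-road statements and the two TREE facts** (`Kato2004.mem_pSmul_of_red_eq_zero_holds`,
`poitouTate_sum_localTatePairing_eq_zero_holds ℚ`, both proved at `p = 2`) — the skeleton v5 composition of `stub_port`.
[cite: Kato2004Asterisque, §13.8 (pp. 228–229)] [cite: MilneADT2006, Ch. I, Thm. 4.10(b)] -/
theorem stub_port_of_rankOne (hG1 : SelmerSideTwo) (hC : ChebotarevTranspositionTwo) (hK : KolyvaginRankOneTwo) :
    CoreTheoremATwoResidue :=
  coreTwoResidue_of_rankOne mem_pSmul_of_red_eq_zero_holds (poitouTate_sum_localTatePairing_eq_zero_holds ℚ) hG1 hC hK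

end Summit.BirchSwinnertonDyer.BirchSwinnertonDyer.Theorems.SteinbergFibreAtTwo

end
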